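import Summits.SmoothPoincare4.SmoothPoincare4.Theorems.ShadowApproximation.Negative.UnitTwist
import Summits.SmoothPoincare4.SmoothPoincare4.Theorems.WaldhausenPairs.Negative.LoadBearing

/-!
# `ShadowApproximation` — negative-side support III: level symmetries need not lift (units obstruction)

Support lemmas for the crux `CongruenceShadows.ShadowApproximation` (stmt-SmoothPoincare4-14595),
standing disprover's work file `Cruxes/ShadowApproximation/Disproof.lean` §6 (cycle 2).

The crux asks: a Waldhausen-normalised balanced group trisection `K` of `{1}` whose shadow at every
characteristic finite-index level `M ≤ S = S_{3+3m}` is standardised by SOME `ψ_M ∈ Aut S`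
(`ψ_M (Nᵢ M) = Kᵢ M`, `N = s4Kernels.stabilizeIter m`) is standard (`Iso N K`). The commutative-
algebra model behind the route (Artin 1969) proves more: STRONG approximation — an actual solution
congruent to the given formal one to any prescribed order. Its analogue here is

* `StrongShadowApproximation`: every level-`M` standardisation `ψ` is congruent modulo `M` to an
  isomorphism of trisections `α` (`α Nᵢ = Kᵢ`, `ψ s · (α s)⁻¹ ∈ M`);
* its `K = N` case `LevelSymmetriesLift`: every symmetry of the level-`M` shadow triple
  `(N₀M, N₁M, N₂M)` is congruent mod `M` to a symmetry of `N` itself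
  ("`Stab(N₀M) ∩ Stab(N₁M) ∩ Stab(N₂M) = (Stab N₀ ∩ Stab N₁ ∩ Stab N₂) · K_M`").

**Both are false, already at genus `3` and at the mod-`5` homology level**
`M₅ = [S₃,S₃]·S₃⁵ = ⋂ ker (S₃ → 𝔽₅)` (`M5`, characteristic of index `5⁶`):
`not_levelSymmetriesLift`, `not_strongShadowApproximation`. Witness: the UNIT TWIST
`δ = τ_a³ ∘ τ_b⁻² ∘ τ_a² ∘ τ_b ∘ τ_a⁻¹ ∈ Aut S₃` (`delta`; `τ_a`, `τ_b` the Dehn twists about `a₀`,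
`b₀`, `twA`, `twB`), supported on handle `0`, acting on `H₁(handle 0) = ℤ⟨a₀,b₀⟩` by
`[[-12, 5], [-5, 2]] ≡ diag(3, 2) (mod 5)` — the split-torus element `h(3) ∈ SL₂(𝔽₅)`.
Modulo `M₅` it multiplies `a₀` by `3` and `b₀` by `2` and fixes the other generators
(`homZ5_delta`), so it stabilises all three level-`5` shadows `Nᵢ ⊔ M₅` (`delta_level`). But no
automorphism `α` stabilising `N₀` and `N₁` is congruent to `δ` mod `M₅`: such an `α` acts on the pair
quotient `S₃ ⧸ (N₀ ⊔ N₁) ≅ F₁ = ℤ` (generated by the class of `b₀`) by `±1`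
(`mulEquiv_infinite_cyclic`), hence `χ(α b₀) = χ(b₀)^{±1}` for the character
`χ = χ_{b₀} : S₃ → 𝔽₅` killing `N₀ ⊔ N₁ ⊔ M₅` (`chi_alpha_b0`), whereas `χ(δ b₀) = χ(b₀)²` and
`2 ≢ ±1 (mod 5)` (`not_lift_delta`).

Moral for provers (Disproof.lean §6): the level-wise standardisations `ψ_M` supplied by the shadow
hypothesis carry a `(ℤ/n)ˣ/{±1}`-valued ambiguity on each pair quotient `S ⧸ KᵢKⱼ ≅ ℤ` (and a
`GL`-over-`𝔽_ℓ` versus `GL`-over-`ℤ` determinant ambiguity on each `S ⧸ Kᵢ ≅ F_g`); a proof of the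
crux must NORMALISE the `ψ_M` (e.g. by composing with unit twists on `N`'s side, which stabilise every
`Nᵢ M`) before any coherence / lifting argument — "take the given `ψ_M` and lift it" is refuted here,
and so is the naive transcription of Artin's strong approximation. This is the machine-checked form of
the planner's "units obstruction" (route NOTES: level stabilisers are never `A·K_M`).
-/

noncomputable section

namespace Summit.SmoothPoincare4.SmoothPoincare4.Theorems.ShadowApproximation.Negative

set_option linter.dupNamespace false

open Literature.Topology.FourManifolds
open Summit.SmoothPoincare4.SmoothPoincare4.Theses.CongruenceShadows
open SurfaceGroup
open Summit.SmoothPoincare4.SmoothPoincare4.Theorems.WaldhausenPairs.Negative (stabilizeIter_isGroupTrisection)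

/-! ## Automorphisms of the pair quotient `S₃ ⧸ (N₀ ⊔ N₁) ≅ ℤ` are `±1` -/

/-- `S₃ ⧸ (N₀ ⊔ N₁)` is free of rank `1` (the pair quotient of the standard trisection). [folklore] -/
theorem isFreeOfRank_quotient_N01 : IsFreeOfRank (S ⧸ (s4Kernels 0 ⊔ s4Kernels 1)) 1 := by
  have h := s4Kernels_isGroupTrisection_holds.free_pairQuotient 0 1 (by decide)
  refine h.of_mulEquiv (QuotientGroup.quotientMulEquivOfEq ?_)
  change Subgroup.normalClosure ((s4Kernels 0 : Set S) ∪ s4Kernels 1) = s4Kernels 0 ⊔ s4Kernels 1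
  exact normalClosure_union_eq_sup _ _

/-- In `F₁`, `t = of 0` has infinite order: `tᵐ = tⁿ → m = n`. [folklore] -/
theorem freeGroup_one_zpow_injective {m n : ℤ}
    (h : (FreeGroup.of 0 : FreeGroup (Fin 1)) ^ m = FreeGroup.of 0 ^ n) : m = n := by
  have := congrArg (FreeGroup.lift fun _ : Fin 1 => Multiplicative.ofAdd (1 : ℤ)) h
  simp only [map_zpow, FreeGroup.lift_apply_of] at this
  rw [← ofAdd_zsmul, ← ofAdd_zsmul] at this
  simpa using this

/-- Every element of `F₁` is a power of `t = of 0`. [folklore] -/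
theorem freeGroup_one_exists_zpow (x : FreeGroup (Fin 1)) : ∃ n : ℤ, (FreeGroup.of 0) ^ n = x := by
  have hr : Set.range (FreeGroup.of : Fin 1 → FreeGroup (Fin 1)) = {FreeGroup.of 0} := by
    ext y
    simp only [Set.mem_range, Set.mem_singleton_iff]
    constructor
    · rintro ⟨i, rfl⟩; rw [Fin.eq_zero i]
    · rintro rfl; exact ⟨0, rfl⟩
  have hx : x ∈ Subgroup.zpowers (FreeGroup.of 0 : FreeGroup (Fin 1)) := by
    rw [Subgroup.zpowers_eq_closure, ← hr, FreeGroup.closure_range_of]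
    trivial
  exact Subgroup.mem_zpowers_iff.1 hx

/-- **Automorphisms of an infinite cyclic group are `x ↦ x^{±1}`.** [folklore] -/
theorem mulEquiv_infinite_cyclic {G : Type*} [Group G] (e : FreeGroup (Fin 1) ≃* G) (β : G ≃* G) :
    ∃ k : ℤ, (k = 1 ∨ k = -1) ∧ ∀ x, β x = x ^ k := by
  set t : G := e (FreeGroup.of 0) with ht
  have hgen : ∀ y : G, ∃ n : ℤ, t ^ n = y := fun y => by
    obtain ⟨n, hn⟩ := freeGroup_one_exists_zpow (e.symm y)
    exact ⟨n, by rw [ht, ← map_zpow, hn, MulEquiv.apply_symm_apply]⟩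
  have hinj : ∀ m n : ℤ, t ^ m = t ^ n → m = n := fun m n h => by
    apply freeGroup_one_zpow_injective
    apply e.injective
    rw [map_zpow, map_zpow, ← ht, h]
  obtain ⟨k, hk⟩ := hgen (β t)
  obtain ⟨l, hl⟩ := hgen (β.symm t)
  have hkl : l * k = 1 := by
    apply hinj
    rw [zpow_one, zpow_mul, hl, ← map_zpow, hk, MulEquiv.symm_apply_apply]
  refine ⟨k, ?_, fun x => ?_⟩
  · rcases Int.eq_one_or_neg_one_of_mul_eq_one' hkl with ⟨-, h⟩ | ⟨-, h⟩
    exacts [Or.inl h, Or.inr h]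
  · obtain ⟨n, rfl⟩ := hgen x
    rw [map_zpow, ← hk, ← zpow_mul, ← zpow_mul, mul_comm]

/-! ## The obstruction -/

/-- The character `χ = χ_{b₀} : S₃ → 𝔽₅` (`b₀ ↦ 1`, other generators `↦ 0`). [folklore] -/
def chiGen (p : surfaceGen 3) : Multiplicative (ZMod 5) :=
  if p = ((0 : Fin 3), true) then Multiplicative.ofAdd 1 else 1

/-- `χ` as a hom. [folklore] -/
def chi : S →* Multiplicative (ZMod 5) := homZ5 chiGen

/-- `χ(b₀) = 1`. [folklore] -/
theorem chi_b0 : chi (b 0) = Multiplicative.ofAdd 1 := by simp [chi, chiGen]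

/-- `χ(δ b₀) = 2 = χ(b₀)²`. [folklore] -/
theorem chi_delta_b0 : chi (delta (b 0)) = Multiplicative.ofAdd 2 := by
  have := DFunLike.congr_fun (homZ5_delta chiGen) (b 0)
  simp only [MonoidHom.comp_apply, MulEquiv.coe_toMonoidHom] at this
  rw [chi, this, homZ5_b]
  simp only [chiGen, cδ]
  decide

/-- `χ` kills `N₀`, `N₁` and `M₅`. [folklore] -/
theorem sup_le_ker_chi : s4Kernels 0 ⊔ s4Kernels 1 ⊔ M5 ≤ chi.ker := by
  refine sup_le (sup_le ?_ ?_) (M5_le_ker chiGen)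
  all_goals
    rw [s4Kernels_eq]
    refine Subgroup.normalClosure_le_normal ?_
    rintro _ ⟨p, hp, rfl⟩
    rw [SetLike.mem_coe, MonoidHom.mem_ker, chi, homZ5_of]
    obtain ⟨i, c⟩ := p
    have hp' : ((i, c) : surfaceGen 3) ∈ (s4Gens _ : Finset _) := hp
    fin_cases i <;> cases c <;> first | exact absurd hp' (by decide) | simp [chiGen]

/-- **`±1` on the pair quotient.** An automorphism stabilising `N₀` and `N₁` multiplies `b₀` by `±1`
modulo `N₀ ⊔ N₁`, hence `χ(α b₀) = χ(b₀)^{±1}`. [folklore] -/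
theorem chi_alpha_b0 (α : S ≃* S) (h0 : (s4Kernels 0).map α.toMonoidHom = s4Kernels 0)
    (h1 : (s4Kernels 1).map α.toMonoidHom = s4Kernels 1) :
    chi (α (b 0)) = Multiplicative.ofAdd 1 ∨ chi (α (b 0)) = (Multiplicative.ofAdd 1)⁻¹ := by
  set P : Subgroup S := s4Kernels 0 ⊔ s4Kernels 1 with hPdef
  have hP : P.map (α : S →* S) = P := by
    have : P.map α.toMonoidHom = P := by rw [hPdef, Subgroup.map_sup, h0, h1]
    simpa using this
  obtain ⟨e⟩ := isFreeOfRank_quotient_N01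
  obtain ⟨k, hk, hβ⟩ := mulEquiv_infinite_cyclic e (QuotientGroup.congr P P α hP)
  have h2 : (QuotientGroup.mk (α (b 0)) : S ⧸ P) = QuotientGroup.mk (b 0 ^ k) := by
    rw [← QuotientGroup.congr_mk P P α hP, hβ, QuotientGroup.mk_zpow]
  rw [QuotientGroup.eq] at h2
  have h3 : chi ((α (b 0))⁻¹ * b 0 ^ k) = 1 :=
    sup_le_ker_chi (Subgroup.mem_sup_left h2)
  rw [map_mul, map_inv, map_zpow, inv_mul_eq_one, chi_b0] at h3
  rcases hk with rfl | rfl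
  · exact Or.inl (by rw [h3, zpow_one])
  · exact Or.inr (by rw [h3, zpow_neg_one])

/-- **The unit twist does not lift.** No automorphism of `S₃` stabilising the standard kernels is
congruent to `δ` modulo `M₅` (indeed none stabilising just `N₀` and `N₁`). [folklore] -/
theorem not_lift_delta : ¬ ∃ α : S ≃* S, (s4Kernels 0).map α.toMonoidHom = s4Kernels 0 ∧
    (s4Kernels 1).map α.toMonoidHom = s4Kernels 1 ∧ ∀ s, delta s * (α s)⁻¹ ∈ M5 := by
  rintro ⟨α, h0, h1, hc⟩
  have hM : chi (delta (b 0) * (α (b 0))⁻¹) = 1 := M5_le_ker chiGen (hc (b 0))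
  rw [map_mul, map_inv, mul_inv_eq_one, chi_delta_b0] at hM
  rcases chi_alpha_b0 α h0 h1 with h | h <;> rw [h] at hM <;> revert hM <;> decide

/-! ## The refuted strengthenings -/

/-- STRENGTHENING "StrongShadowApproximation" (Artin-style strong approximation: every level-`M`
standardisation `ψ` of a normalised group trisection `K` of `{1}` is congruent mod `M` to an
isomorphism `N ≅ K`) implies the crux — take the given `ψ_M` at any level, e.g. `M = ⊤`.
(It is refuted below: `not_strongShadowApproximation`.) [folklore] -/
theorem shadowApproximation_of_strong
    (h : ∀ (m : ℕ) (K : TrisectionKernels (3 + 3 * m)),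
      IsGroupTrisection (3 + 3 * m) (m + 1) (PUnit : Type) K →
      (∀ i j : Fin 3, i ≠ j → ∃ α : SurfaceGroup (3 + 3 * m) ≃* SurfaceGroup (3 + 3 * m),
        (s4Kernels.stabilizeIter m i).map α.toMonoidHom = K i ∧
          (s4Kernels.stabilizeIter m j).map α.toMonoidHom = K j) →
      ∀ M : Subgroup (SurfaceGroup (3 + 3 * m)), M.Characteristic → M.FiniteIndex →
      ∀ ψ : SurfaceGroup (3 + 3 * m) ≃* SurfaceGroup (3 + 3 * m),
        (∀ i : Fin 3, (s4Kernels.stabilizeIter m i ⊔ M).map ψ.toMonoidHom = K i ⊔ M) →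
        ∃ α : SurfaceGroup (3 + 3 * m) ≃* SurfaceGroup (3 + 3 * m),
          (∀ i, (s4Kernels.stabilizeIter m i).map α.toMonoidHom = K i) ∧ ∀ s, ψ s * (α s)⁻¹ ∈ M) :
    ShadowApproximation := by
  intro m K hK hW hS
  obtain ⟨ψ, hψ⟩ := hS ⊤ inferInstance inferInstance
  obtain ⟨α, hα, -⟩ := h m K hK hW ⊤ inferInstance inferInstance ψ hψ
  exact ⟨α, hα⟩

/-- **Level symmetries need not lift** ("LevelSymmetriesLift", the `K = N` case of the strong form:
every symmetry of the level-`M` shadow of the standard trisection is congruent mod `M` to a symmetry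
of the standard trisection) is FALSE — genus 3, level `M₅`, witness the unit twist `δ`. [folklore] -/
theorem not_levelSymmetriesLift :
    ¬ ∀ (m : ℕ) (M : Subgroup (SurfaceGroup (3 + 3 * m))), M.Characteristic → M.FiniteIndex →
      ∀ ψ : SurfaceGroup (3 + 3 * m) ≃* SurfaceGroup (3 + 3 * m),
        (∀ i : Fin 3, (s4Kernels.stabilizeIter m i ⊔ M).map ψ.toMonoidHom =
          s4Kernels.stabilizeIter m i ⊔ M) →
        ∃ α : SurfaceGroup (3 + 3 * m) ≃* SurfaceGroup (3 + 3 * m),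
          (∀ i, (s4Kernels.stabilizeIter m i).map α.toMonoidHom = s4Kernels.stabilizeIter m i) ∧
            ∀ s, ψ s * (α s)⁻¹ ∈ M := by
  intro h
  obtain ⟨α, hα, hc⟩ := h 0 M5 M5_characteristic M5_finiteIndex delta delta_level
  exact not_lift_delta ⟨α, hα 0, hα 1, hc⟩

/-- **Strong shadow approximation is false**: the Artin-style strong form of the crux
`ShadowApproximation` (stmt-SmoothPoincare4-14595) fails at genus 3 (specialise to `K = N`, which
is a normalised group trisection of `{1}`, and apply `not_levelSymmetriesLift`). [folklore] -/
theorem not_strongShadowApproximation :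
    ¬ ∀ (m : ℕ) (K : TrisectionKernels (3 + 3 * m)),
      IsGroupTrisection (3 + 3 * m) (m + 1) (PUnit : Type) K →
      (∀ i j : Fin 3, i ≠ j → ∃ α : SurfaceGroup (3 + 3 * m) ≃* SurfaceGroup (3 + 3 * m),
        (s4Kernels.stabilizeIter m i).map α.toMonoidHom = K i ∧
          (s4Kernels.stabilizeIter m j).map α.toMonoidHom = K j) →
      ∀ M : Subgroup (SurfaceGroup (3 + 3 * m)), M.Characteristic → M.FiniteIndex →
      ∀ ψ : SurfaceGroup (3 + 3 * m) ≃* SurfaceGroup (3 + 3 * m),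
        (∀ i : Fin 3, (s4Kernels.stabilizeIter m i ⊔ M).map ψ.toMonoidHom = K i ⊔ M) →
        ∃ α : SurfaceGroup (3 + 3 * m) ≃* SurfaceGroup (3 + 3 * m),
          (∀ i, (s4Kernels.stabilizeIter m i).map α.toMonoidHom = K i) ∧ ∀ s, ψ s * (α s)⁻¹ ∈ M :=
  fun h => not_levelSymmetriesLift fun m M hM hF ψ hψ =>
    h m _ (stabilizeIter_isGroupTrisection m) (fun _ _ _ => ⟨MulEquiv.refl _, by simp, by simp⟩)
      M hM hF ψ hψ

end Summit.SmoothPoincare4.SmoothPoincare4.Theorems.ShadowApproximation.Negative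

end
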